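import Summits.ValiantsHypothesis.ValiantsHypothesis.Theorems.DivisionGapPerDivisionHardStubSparseRigidFlow

/-!
# Crux `DivisionGap.PerDivisionHard` (stmt-ValiantsHypothesis-5065), line
`pair-descent-jss-endpoint` — stub `stub_pathRigidity` (fibre differences run along WHOLE paths)

On a placed block arsenal `G(b,k) ⊕ M₀` (`BlockV`, `blockAdj`, `placedBlock` of
`Theorems/DivisionGapDefs.lean`, `k ≥ 1`) two monomials `m₁, m₂` of a torus-homogeneous `h`
(equal row margins `rowDegrees`, equal column margins `Finsupp.mapDomain Prod.snd`) that agree off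
the placed face and differ at SOME cell of the subdivision path `(i, j)` differ at EVERY cell of
that path.

Proof.  The difference `D = m₁ - m₂` (an integer matrix) is supported on the placed face and has
vanishing row and column sums, so its pull-back to label coordinates is a circulation
(`labelFlow_of_placed`).  By the flow calculus of
`Theorems/DivisionGapPerDivisionHardStubSparseRigidFlow.lean` (`flow_path`) a circulation carries
`∓ pathVal` on the two cells of every internal row `(i, j, t)` of the path, and `pathVal` on its
first cell (core row `i`, column `(i, j, 0)`); these are all the cells of the path
(`adj_internalRow`).  Hence `D = ± pathVal (i, j)` on every path cell, and one nonzero value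
forces all of them to be nonzero.
-/

noncomputable section

-- `Summit.ValiantsHypothesis.ValiantsHypothesis.…` is the tree's mandated single-conjunct layout
-- (Sub = Summit), so the duplicated namespace component is intended.
set_option linter.dupNamespace false

namespace Summit.ValiantsHypothesis.ValiantsHypothesis.Theorems.DivisionGapPerDivisionHard

open MvPolynomial Literature.Computability.AlgebraicComplexity
open scoped NNReal

variable {b k m n : ℕ}

/-! ### Margins as sums -/

/-- The margin of `mapDomain f μ` at `a` is the sum of `μ` over the fibre of `a`. [folklore] -/
private theorem mapDomain_apply_eq_sum_fibre (f : Fin n × Fin n → Fin n) (μ : (Fin n × Fin n) →₀ ℕ)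
    (a : Fin n) : Finsupp.mapDomain f μ a = ∑ x, if f x = a then μ x else 0 := by
  -- adapted from `mapDomain_apply_eq_sum` of `DivisionGapPerDivisionHardStubSparseRigidCount.lean`
  rw [Finsupp.mapDomain, Finsupp.sum_apply, Finsupp.sum_fintype _ _ (fun _ => by simp)]
  simp only [Finsupp.single_apply]

/-- Row margins as row sums. [folklore] -/
private theorem rowDegrees_eq_sum_row (μ : (Fin n × Fin n) →₀ ℕ) (r : Fin n) :
    rowDegrees μ r = ∑ c, μ (r, c) := by
  -- adapted from `rowDegrees_apply` of `DivisionGapPerDivisionHardStubSparseRigidCount.lean`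
  rw [rowDegrees, mapDomain_apply_eq_sum_fibre, Fintype.sum_prod_type, Finset.sum_comm]
  refine Finset.sum_congr rfl fun c _ => ?_
  rw [Finset.sum_ite_eq', if_pos (Finset.mem_univ _)]

/-- Column margins as column sums. [folklore] -/
private theorem colDegrees_eq_sum_col (μ : (Fin n × Fin n) →₀ ℕ) (c : Fin n) :
    Finsupp.mapDomain Prod.snd μ c = ∑ r, μ (r, c) := by
  -- adapted from `colDegrees_apply` of `DivisionGapPerDivisionHardStubSparseRigidCount.lean`
  rw [mapDomain_apply_eq_sum_fibre, Fintype.sum_prod_type]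
  refine Finset.sum_congr rfl fun r _ => ?_
  rw [Finset.sum_ite_eq' Finset.univ c (fun x => μ (r, x)), if_pos (Finset.mem_univ _)]

/-! ### The values of a placed circulation on a path -/

/-- **Path cells carry `± pathVal`.**  An integer matrix supported on the placed block graph
(`k ≥ 1`) with vanishing row and column sums takes, on every cell of the subdivision path
`(i, j)` — the first cell (row label `inl i`, column label `(i, j, 0)`) or a cell of an internal
row `(i, j, t)` — the value `pathVal (i, j)` or `-pathVal (i, j)` of its label circulation.
[folklore] -/
theorem placedFlow_pathCell_eq_or (eR eC : BlockV b k m ≃ Fin n) {D : Fin n × Fin n → ℤ}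
    (hG : ∀ e, D e ≠ 0 → e ∈ placedBlock eR eC)
    (hrow : ∀ r, ∑ c, D (r, c) = 0) (hcol : ∀ c, ∑ r, D (r, c) = 0) (hk : 0 < k) (i j : Fin b)
    {e : Fin n × Fin n} (he : e ∈ placedBlock eR eC)
    (hp : (eR.symm e.1 = Sum.inl i ∧
        ∃ t : Fin k, (t : ℕ) = 0 ∧ eC.symm e.2 = Sum.inr (Sum.inl (i, j, t))) ∨
      ∃ t : Fin k, eR.symm e.1 = Sum.inr (Sum.inl (i, j, t))) :
    D e = pathVal (fun r ℓ => D (eR r, eC ℓ)) hk i j ∨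
      D e = -pathVal (fun r ℓ => D (eR r, eC ℓ)) hk i j := by
  have hF := labelFlow_of_placed eR eC hG hrow hcol
  have hDe : D e = D (eR (eR.symm e.1), eC (eC.symm e.2)) := by
    rw [Equiv.apply_symm_apply, Equiv.apply_symm_apply]
  rcases hp with ⟨hr, t, ht, hc⟩ | ⟨⟨t, ht⟩, hr⟩
  · -- the first cell of the path
    obtain rfl : t = ⟨0, hk⟩ := Fin.ext ht
    left
    rw [hDe, hr, hc]
    rfl
  · -- a cell of the internal row `(i, j, t)`: its own column or the next column
    have hadj : blockAdj b k m (eR.symm e.1) (eC.symm e.2) = true := by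
      simpa [placedBlock] using he
    rw [hr] at hadj
    have hpth := flow_path hF hk i j t ht
    rcases adj_internalRow (i := i) (j := j) (t := ⟨t, ht⟩) hadj with hc | hc
    · right
      rw [hDe, hr, hc]
      exact hpth.1
    · left
      rw [hDe, hr, hc]
      exact hpth.2

/-! ### The stub -/

/-- **`stub_pathRigidity` — fibre differences run along WHOLE paths.**  On a placed
`G(b,k) ⊕ M₀` (`k ≥ 1`), two monomials of a torus-homogeneous `h` that agree off the placed face
and differ at some cell of the subdivision path `(i, j)` differ at EVERY cell of that path: the
difference `m₁ - m₂` is a circulation of the placed block graph, which carries `± pathVal (i, j)`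
on every cell of the path (`placedFlow_pathCell_eq_or`).  Path cells: row label `inl i` with
column label `(i, j, 0)`, or row label an internal vertex `(i, j, t)`. [folklore] -/
theorem stub_pathRigidity :
    ∀ (b k m n : ℕ) (eR eC : BlockV b k m ≃ Fin n) (h : MvPolynomial (Fin n × Fin n) ℝ≥0)
      (m₁ m₂ : (Fin n × Fin n) →₀ ℕ) (i j : Fin b), 0 < k → IsTorusHomogeneous h →
      m₁ ∈ h.support → m₂ ∈ h.support → (∀ e ∉ placedBlock eR eC, m₁ e = m₂ e) →
      (∃ e ∈ placedBlock eR eC,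
        ((eR.symm e.1 = Sum.inl i ∧ ∃ t : Fin k, (t : ℕ) = 0 ∧ eC.symm e.2 = Sum.inr (Sum.inl (i, j, t))) ∨
          ∃ t : Fin k, eR.symm e.1 = Sum.inr (Sum.inl (i, j, t))) ∧ m₁ e ≠ m₂ e) →
      ∀ e ∈ placedBlock eR eC,
        ((eR.symm e.1 = Sum.inl i ∧ ∃ t : Fin k, (t : ℕ) = 0 ∧ eC.symm e.2 = Sum.inr (Sum.inl (i, j, t))) ∨
          ∃ t : Fin k, eR.symm e.1 = Sum.inr (Sum.inl (i, j, t))) → m₁ e ≠ m₂ e := by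
  intro b k m n eR eC h m₁ m₂ i j hk htor hm₁ hm₂ hoff hex e he hp
  obtain ⟨e₀, he₀, hp₀, hne₀⟩ := hex
  -- the difference matrix: supported on the placed face, vanishing row and column sums
  let D : Fin n × Fin n → ℤ := fun e => (m₁ e : ℤ) - m₂ e
  have hDiff : ∀ e, D e ≠ 0 ↔ m₁ e ≠ m₂ e := fun e => by
    simp only [D, ne_eq, sub_eq_zero, Nat.cast_inj]
  have hG : ∀ e, D e ≠ 0 → e ∈ placedBlock eR eC := fun e hne => by
    by_contra hc
    exact (hDiff e).1 hne (hoff e hc)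
  obtain ⟨ρ, γ, hrc⟩ := htor
  have hrow : ∀ r, ∑ c, D (r, c) = 0 := fun r => by
    simp only [D]
    rw [Finset.sum_sub_distrib, ← Nat.cast_sum, ← Nat.cast_sum, ← rowDegrees_eq_sum_row,
      ← rowDegrees_eq_sum_row, (hrc m₁ hm₁).1, (hrc m₂ hm₂).1, sub_self]
  have hcol : ∀ c, ∑ r, D (r, c) = 0 := fun c => by
    simp only [D]
    rw [Finset.sum_sub_distrib, ← Nat.cast_sum, ← Nat.cast_sum, ← colDegrees_eq_sum_col,
      ← colDegrees_eq_sum_col, (hrc m₁ hm₁).2, (hrc m₂ hm₂).2, sub_self]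
  -- every cell of the path `(i, j)` carries `± pathVal`, and one of them is nonzero
  have h₀ := placedFlow_pathCell_eq_or eR eC hG hrow hcol hk i j he₀ hp₀
  have h₁ := placedFlow_pathCell_eq_or eR eC hG hrow hcol hk i j he hp
  have hne : D e₀ ≠ 0 := (hDiff e₀).2 hne₀
  have hpv : pathVal (fun r ℓ => D (eR r, eC ℓ)) hk i j ≠ 0 := by
    rcases h₀ with h₀ | h₀
    · rwa [h₀] at hne
    · rw [h₀] at hne
      exact neg_ne_zero.mp hne
  refine (hDiff e).1 ?_
  rcases h₁ with h₁ | h₁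
  · rwa [h₁]
  · rw [h₁]
    exact neg_ne_zero.mpr hpv

end Summit.ValiantsHypothesis.ValiantsHypothesis.Theorems.DivisionGapPerDivisionHard

end
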